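import Literature.Geometry.Lorentzian.KerrSchildEnergyEstimate
import Literature.Analysis.ODE.ConstCoeffL2Vanishing

/-!
# Route ClusterCompleteness — crux `AdiabaticMultiKerrILED`, line `Sketch`: propagation of the
# Hardy-type decay from the initial leaf to later leaves (stub `leaf_hardyDecay_propagate`)

Helper file for the crux `stmt-FinalStateConjecture-14310`
(`Summit.FinalStateConjecture.FinalStateConjecture.Theses.ClusterCompleteness.AdiabaticMultiKerrILED`),
closing the stub `leaf_hardyDecay_propagate` of line `Sketch`. The degenerate Morawetz estimate
needs, on every leaf `{x⁰ = s + F(y)}`, the decay `∫_{ρ < ‖y‖} Φ²/‖y‖² dy < ∞` of the solution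
`Φ`; the crux only provides it on the initial leaf `s = 0`. Here it is propagated in `s`: if
`Φ ∈ C¹(ℝ⁴)`, the decay holds on the leaf `s = 0`, and the time derivative `∂₀Φ` has finite
space-time `L²` norm on the slab `(0, s] × {ρ < ‖y‖}` (in the leaf parametrisation
`(u, y) ↦ (u + F y, y)`), then the decay holds on the leaf `s`.

Proof (pure real analysis). For fixed `y`, the fundamental theorem of calculus along the vertical
line `u ↦ (u + F y, y)` gives `Φ(s + F y, y) − Φ(F y, y) = ∫₀ˢ ∂₀Φ(u + F y, y) du`, so by
Cauchy–Schwarz `Φ_s² ≤ 2 Φ_0² + 2 s ∫₀ˢ (∂₀Φ)²`; dividing by `‖y‖² ≥ ρ²` (keeping `1/‖y‖²` on the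
`Φ_0` term and bounding it by `1/ρ²` on the derivative term) and integrating over `{ρ < ‖y‖}`
(Tonelli to exchange the `u`- and `y`-integrations) gives
`∫ Φ_s²/‖y‖² ≤ 2 ∫ Φ_0²/‖y‖² + (2s/ρ²) ∫₀ˢ ∫ (∂₀Φ)² < ∞`. [folklore]
-/

noncomputable section

-- the doubled `FinalStateConjecture.FinalStateConjecture` path component trips dupNamespace
set_option linter.dupNamespace false

open Literature.Geometry.Lorentzian MeasureTheory Set Filter
open scoped Topology ENNReal

namespace Summit.FinalStateConjecture.FinalStateConjecture.Theorems

/-- **Energy-type bound along a line.** If `φ : ℝ → ℝ` has the continuous derivative `φ'` and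
`0 ≤ s`, then `φ(s)² ≤ 2 φ(0)² + 2 s ∫_{(0, s]} φ'²` (fundamental theorem of calculus and
Cauchy–Schwarz on `[0, s]`). [folklore] -/
theorem sq_le_two_mul_sq_add_of_hasDerivAt {φ φ' : ℝ → ℝ} {s : ℝ} (hs : 0 ≤ s)
    (hderiv : ∀ u, HasDerivAt φ (φ' u) u) (hcont : Continuous φ') :
    φ s ^ 2 ≤ 2 * φ 0 ^ 2 + 2 * s * ∫ u in Ioc 0 s, φ' u ^ 2 := by
  have hftc : ∫ u in (0 : ℝ)..s, φ' u = φ s - φ 0 :=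
    intervalIntegral.integral_eq_sub_of_hasDerivAt (fun u _ => hderiv u) (hcont.intervalIntegrable 0 s)
  have hcs := Literature.Analysis.ODE.sq_intervalIntegral_le hcont hs
  rw [hftc, sub_zero, intervalIntegral.integral_of_le hs] at hcs
  nlinarith [hcs, sq_nonneg (φ s - 2 * φ 0)]

/-- **Propagation of a weighted `L²` bound by a space-time `L²` bound on the derivative**
(abstract form). Let `S ⊆ E3` be measurable with `ρ ≤ ‖y‖` on `S` (`ρ > 0`), and let
`g, D : ℝ → E3 → ℝ` with `∂_u g(u, y) = D(u, y)`, `D` jointly continuous and `g(0, ·)`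
continuous. If `∫_S g(0, y)²/‖y‖² < ∞` and `∫_{(0, s]} ∫_S D² < ∞`, then `∫_S g(s, y)²/‖y‖² < ∞`:
pointwise `g(s, y)²/‖y‖² ≤ 2 g(0, y)²/‖y‖² + (2 s/ρ²) ∫_{(0,s]} D(u, y)² du`
(`sq_le_two_mul_sq_add_of_hasDerivAt`), then integrate over `S` and use Tonelli. [folklore] -/
theorem setLIntegral_sq_div_lt_top_of_hasDerivAt {S : Set E3} (hS : MeasurableSet S) {ρ s : ℝ}
    (hρ : 0 < ρ) (hs : 0 ≤ s) (hSρ : ∀ y ∈ S, ρ ≤ ‖y‖) {g D : ℝ → E3 → ℝ}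
    (hderiv : ∀ y u, HasDerivAt (fun u => g u y) (D u y) u)
    (hg0 : Continuous fun y => g 0 y) (hD : Continuous fun p : ℝ × E3 => D p.1 p.2)
    (h0 : ∫⁻ y in S, ENNReal.ofReal (g 0 y ^ 2 / ‖y‖ ^ 2) < ⊤)
    (h1 : ∫⁻ u in Ioc 0 s, ∫⁻ y in S, ENNReal.ofReal (D u y ^ 2) < ⊤) :
    ∫⁻ y in S, ENNReal.ofReal (g s y ^ 2 / ‖y‖ ^ 2) < ⊤ := by
  have hDy : ∀ y : E3, Continuous fun u : ℝ => D u y := fun y =>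
    hD.comp (continuous_id.prodMk continuous_const)
  -- the pointwise bound on `S`
  have hpt : ∀ y ∈ S, ENNReal.ofReal (g s y ^ 2 / ‖y‖ ^ 2) ≤
      2 * ENNReal.ofReal (g 0 y ^ 2 / ‖y‖ ^ 2) +
        ENNReal.ofReal (2 * s / ρ ^ 2) * ∫⁻ u in Ioc 0 s, ENNReal.ofReal (D u y ^ 2) := by
    intro y hy
    have hyρ : ρ ≤ ‖y‖ := hSρ y hy
    set I : ℝ := ∫ u in Ioc 0 s, D u y ^ 2 with hI
    have hI0 : 0 ≤ I := integral_nonneg fun u => sq_nonneg _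
    have hint : IntegrableOn (fun u => D u y ^ 2) (Ioc 0 s) := ((hDy y).pow 2).integrableOn_Ioc
    have hkey : g s y ^ 2 ≤ 2 * g 0 y ^ 2 + 2 * s * I :=
      sq_le_two_mul_sq_add_of_hasDerivAt hs (hderiv y) (hDy y)
    have hsI : 0 ≤ 2 * s * I := by positivity
    have hreal : g s y ^ 2 / ‖y‖ ^ 2 ≤ 2 * (g 0 y ^ 2 / ‖y‖ ^ 2) + 2 * s / ρ ^ 2 * I := by
      have h2 : 2 * s * I / ‖y‖ ^ 2 ≤ 2 * s * I / ρ ^ 2 :=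
        div_le_div_of_nonneg_left hsI (by positivity) (pow_le_pow_left₀ hρ.le hyρ 2)
      calc g s y ^ 2 / ‖y‖ ^ 2 ≤ (2 * g 0 y ^ 2 + 2 * s * I) / ‖y‖ ^ 2 :=
            div_le_div_of_nonneg_right hkey (sq_nonneg _)
        _ = 2 * (g 0 y ^ 2 / ‖y‖ ^ 2) + 2 * s * I / ‖y‖ ^ 2 := by ring
        _ ≤ 2 * (g 0 y ^ 2 / ‖y‖ ^ 2) + 2 * s * I / ρ ^ 2 := by linarith
        _ = 2 * (g 0 y ^ 2 / ‖y‖ ^ 2) + 2 * s / ρ ^ 2 * I := by ring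
    have hc0 : 0 ≤ 2 * (g 0 y ^ 2 / ‖y‖ ^ 2) := by positivity
    have hc1 : 0 ≤ 2 * s / ρ ^ 2 := by positivity
    calc ENNReal.ofReal (g s y ^ 2 / ‖y‖ ^ 2)
        ≤ ENNReal.ofReal (2 * (g 0 y ^ 2 / ‖y‖ ^ 2) + 2 * s / ρ ^ 2 * I) :=
          ENNReal.ofReal_le_ofReal hreal
      _ = 2 * ENNReal.ofReal (g 0 y ^ 2 / ‖y‖ ^ 2) +
            ENNReal.ofReal (2 * s / ρ ^ 2) * ENNReal.ofReal I := by
          rw [ENNReal.ofReal_add hc0 (mul_nonneg hc1 hI0), ENNReal.ofReal_mul zero_le_two,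
            ENNReal.ofReal_mul hc1, ENNReal.ofReal_ofNat]
      _ = 2 * ENNReal.ofReal (g 0 y ^ 2 / ‖y‖ ^ 2) +
            ENNReal.ofReal (2 * s / ρ ^ 2) * ∫⁻ u in Ioc 0 s, ENNReal.ofReal (D u y ^ 2) := by
          rw [hI, ofReal_integral_eq_lintegral_ofReal hint (ae_of_all _ fun u => sq_nonneg (D u y))]
  -- measurability of the initial-leaf integrand and of the space-time integrand
  have hmeas0 : Measurable fun y : E3 => ENNReal.ofReal (g 0 y ^ 2 / ‖y‖ ^ 2) :=
    ((hg0.pow 2).measurable.div (continuous_norm.pow 2).measurable).ennreal_ofReal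
  have hmeasD : Measurable (Function.uncurry fun (y : E3) (u : ℝ) => ENNReal.ofReal (D u y ^ 2)) :=
    ((hD.comp continuous_swap).pow 2).measurable.ennreal_ofReal
  have hswap : ∫⁻ y in S, ∫⁻ u in Ioc 0 s, ENNReal.ofReal (D u y ^ 2) =
      ∫⁻ u in Ioc 0 s, ∫⁻ y in S, ENNReal.ofReal (D u y ^ 2) :=
    lintegral_lintegral_swap hmeasD.aemeasurable
  calc ∫⁻ y in S, ENNReal.ofReal (g s y ^ 2 / ‖y‖ ^ 2)
      ≤ ∫⁻ y in S, (2 * ENNReal.ofReal (g 0 y ^ 2 / ‖y‖ ^ 2) +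
          ENNReal.ofReal (2 * s / ρ ^ 2) * ∫⁻ u in Ioc 0 s, ENNReal.ofReal (D u y ^ 2)) :=
        setLIntegral_mono' hS hpt
    _ = (2 * ∫⁻ y in S, ENNReal.ofReal (g 0 y ^ 2 / ‖y‖ ^ 2)) +
          ENNReal.ofReal (2 * s / ρ ^ 2) * ∫⁻ u in Ioc 0 s, ∫⁻ y in S, ENNReal.ofReal (D u y ^ 2) := by
        rw [lintegral_add_left (hmeas0.const_mul 2), lintegral_const_mul 2 hmeas0,
          lintegral_const_mul' _ _ ENNReal.ofReal_ne_top, hswap]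
    _ < ⊤ := ENNReal.add_lt_top.2
        ⟨ENNReal.mul_lt_top ENNReal.ofNat_lt_top h0, ENNReal.mul_lt_top ENNReal.ofReal_lt_top h1⟩

/-- **Propagation of the Hardy-type decay along the leaves** (stub `leaf_hardyDecay_propagate`
of line `Sketch` of the crux `AdiabaticMultiKerrILED`): for `F ∈ C¹(E3)`, `Φ ∈ C¹(E4)`, `0 ≤ s`,
`0 < ρ`, if `∫_{ρ < ‖y‖} Φ(F y, y)²/‖y‖² dy < ∞` and
`∫_{(0, s]} ∫_{ρ < ‖y‖} (∂₀Φ)(u + F y, y)² dy du < ∞`, then `∫_{ρ < ‖y‖} Φ(s + F y, y)²/‖y‖² dy < ∞`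
(fundamental theorem of calculus along `u ↦ (u + F y, y)`, Cauchy–Schwarz, Tonelli;
`setLIntegral_sq_div_lt_top_of_hasDerivAt`). [folklore] -/
theorem leaf_hardyDecay_propagate : ∀ (F : E3 → ℝ) (Φ : E4 → ℝ) (s ρ : ℝ), ContDiff ℝ 1 F → ContDiff ℝ 1 Φ → 0 ≤ s → 0 < ρ → (∫⁻ y in {y : E3 | ρ < ‖y‖}, ENNReal.ofReal (Φ (E4.ofTimeSpace (0 + F y) y) ^ 2 / ‖y‖ ^ 2) < ⊤) → (∫⁻ u in Set.Ioc 0 s, ∫⁻ y in {y : E3 | ρ < ‖y‖}, ENNReal.ofReal (fderiv ℝ Φ (E4.ofTimeSpace (u + F y) y) (E4.basisVector 0) ^ 2) < ⊤) → ∫⁻ y in {y : E3 | ρ < ‖y‖}, ENNReal.ofReal (Φ (E4.ofTimeSpace (s + F y) y) ^ 2 / ‖y‖ ^ 2) < ⊤ := by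
  intro F Φ s ρ hF hΦ hs hρ h0 h1
  have hSm : MeasurableSet {y : E3 | ρ < ‖y‖} :=
    (isOpen_lt continuous_const continuous_norm).measurableSet
  -- the leaf parametrisation `(u, y) ↦ (u + F y, y)` is continuous, with `u`-derivative `∂₀`
  have hleafc : Continuous fun p : ℝ × E3 => E4.ofTimeSpace (p.1 + F p.2) p.2 :=
    E4.continuous_ofTimeSpace_uncurry.comp
      ((continuous_fst.add (hF.continuous.comp continuous_snd)).prodMk continuous_snd)
  have hleafd : ∀ (y : E3) (u : ℝ),
      HasDerivAt (fun u : ℝ => E4.ofTimeSpace (u + F y) y) (E4.basisVector 0) u := fun y u =>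
    HasDerivAt.comp_add_const u (F y) (E4.hasDerivAt_ofTimeSpace_left (u + F y) y)
  have hdiff : Differentiable ℝ Φ := hΦ.differentiable one_ne_zero
  refine setLIntegral_sq_div_lt_top_of_hasDerivAt hSm hρ hs (fun y hy => le_of_lt hy)
    (g := fun u y => Φ (E4.ofTimeSpace (u + F y) y))
    (D := fun u y => fderiv ℝ Φ (E4.ofTimeSpace (u + F y) y) (E4.basisVector 0))
    (fun y u => (hdiff _).hasFDerivAt.comp_hasDerivAt u (hleafd y u)) ?_ ?_ h0 h1
  · exact hΦ.continuous.comp (hleafc.comp (continuous_const.prodMk continuous_id))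
  · exact ((hΦ.continuous_fderiv one_ne_zero).comp hleafc).clm_apply continuous_const

end Summit.FinalStateConjecture.FinalStateConjecture.Theorems

end
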